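import Summits.AtomisticToContinuum.Crystallization.Theorems.PerronTransitivityUniformBindingRigiditySplit
import Summits.AtomisticToContinuum.Crystallization.Theorems.PalmUnimodularRigidityShellsToBarlowChart
import Summits.AtomisticToContinuum.Crystallization.Theorems.PerronTransitivityUniformBindingRigidityCohesionO

/-!
# Skeleton line `shell-census-layer-lock` — crux `UniformBindingRigidity` (`M*`)
# (stmt-AtomisticToContinuum-15099, route `PerronTransitivity`, sub-problem `Crystallization`)

Strategist's ALTERNATIVE line (crux-strategist `cstrat-stmt-AtomisticToContinuum-15099-s1`; the live
registered line is `Lines/birth.lean`, rev 4, untouched).  TRANSFER at crux level: the solved sibling step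
is the ROBUST LAYER THEOREM `ShellsToBarlowChart` of route `PalmUnimodularRigidity`
(stmt-AtomisticToContinuum-9227, CLOSED·proved, `…Cruxes.ShellsToBarlowChart.DevelopTheModelGrowthDescent.ShellsToBarlowChart_of`,
file `Theorems/PalmUnimodularRigidityShellsToBarlowChart.lean`): a non-empty `S ⊆ ℝ³` in which EVERY point
has a `1 %`-close-packed twelve-neighbour first shell at its own scale `a ∈ [9/10, 1]` is globally
bond-isomorphic to an ideal Barlow stacking.  It is pure geometry and applies to the deterministic `X` of
`M*` verbatim, so the monolithic `stub_barlowChart` of the registered line (global combinatorics + local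
frustration + metric rigidity in one statement) is cut into

* `stub_localHalfSpaceCert` (L, shared with the registered line rev 5) — the finite-radius half-space certificate;
* `stub_shellCensus`  (L/XL) — uniform `2e*`-binding ⇒ every first shell is `1 %`-close-packed
                        (the tetrahedral-frustration step in its WEAKEST pointwise form: first shell only,
                        tolerance `a/100`, no global structure claimed);
* the landed layer theorem (FREE) — ⇒ `X` is bond-isomorphic to `barlowStacking 1 √(2/3) s`;
* `stub_metricLock`   (XL, HARDEST) — a uniformly `2e*`-bound, `1 %`-close-packed, Barlow-bond-isomorphic
                        Delone set is an EXACT rigid image of a Barlow stacking in the registry box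
                        (one-sided Liouville on a FIXED topology: zero slack ⇒ the displacement field is
                        a rigid motion and `(a, h)` is pinned into the box);

and the cohesion stub `stub_localHalfSpaceCert` `(LOCAL at 23/40, radius 6)` is SHARED VERBATIM (same name, same
statement) with the registered line rev 5, so a stub-worker closing it closes it for both lines; the landed
reductions `halfSpaceCore_of_localSharp` (p169668: `(LOCAL♯) ⇒ (CORE)`, using the landed separation bootstrap
`1/4 → 23/40`) and `stub_local_of_finiteCert_sharp` (`FINCERT(R') ⇒ (LOCAL♯)`) apply unchanged.
Composition: `UniformBindingRigidity_of : (LOCAL♯) → (CENSUS) → (LOCK) → UniformBindingRigidity` through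
`halfSpaceCore_of_localSharp`, the landed split glue `UniformBindingRigidity_of_subs` (p169444) and the landed
layer theorem — kernel-checked, `sorry` only inside the three `stub_*`.
-/

noncomputable section

namespace Summit.AtomisticToContinuum.Crystallization.Cruxes.UniformBindingRigidity.ShellCensusLayerLock

open Literature.MathematicalPhysics.StatisticalMechanics
open Literature.Geometry.DiscreteGeometry
open Summit.AtomisticToContinuum.Crystallization.Theses.PerronTransitivity (UniformBindingRigidity)

/-- **stub 1 — LOCAL HALF-SPACE CERTIFICATE `(LOCAL♯)`** (= the registered rev-5 stub
`stub_localHalfSpaceCert`, VERBATIM — shared with the live line; size L: a finite certified computation by the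
landed reduction `stub_local_of_finiteCert_sharp`): no `23/40`-separated configuration through `0` in the closed
lower half-space `{⟪·,u⟫ ≤ 0}` has all its Lennard-Jones site sums within distance `6` of `0` bounded by `−711/500`.
`e*`-free, crystal-problem-free, finite-radius; it gives the split child `UniformBindingHalfSpaceCore` `(CORE)` ALONE
(`halfSpaceCore_of_localSharp`, landed p169668).  Why it might fail: a cloud-type witness (cf. `Negative/DepthZero`
at separation `1/4`, radius `0`) surviving separation `23/40` and radius `6` — then raise the radius (`8`) first. -/
theorem stub_localHalfSpaceCert :
    ∀ (Y : Set (EuclideanSpace ℝ (Fin 3))) (u : EuclideanSpace ℝ (Fin 3)), ‖u‖ = 1 →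
      (0 : EuclideanSpace ℝ (Fin 3)) ∈ Y →
      (∀ p ∈ Y, ∀ q ∈ Y, p ≠ q → 23 / 40 ≤ dist p q) →
      (∀ q ∈ Y, inner ℝ q u ≤ 0) →
      (∀ p ∈ Y, dist p 0 ≤ 6 → ∑' q : {q : EuclideanSpace ℝ (Fin 3) // q ∈ Y ∧ q ≠ p},
          lennardJones (dist p q.1) ≤ -(711 / 500)) →
      False := by
  sorry

/-- **stub 2 — TWELVE-SHELL CENSUS `(CENSUS)`** (size L/XL; the frustration step, pointwise and
first-shell only): every site `x` of a non-empty, uniformly discrete, relatively dense, uniformly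
`2e*`-bound `X ⊆ ℝ³` has, at some scale `a ∈ [9/10, 1]`, exactly a `1 %`-close-packed first shell — the
points of `X ∖ {x}` within `5a/4` of `x`, recentred at `x`, are `(a/100)`-matched after a linear isometry
to the `a`-scaled FCC (cuboctahedron) or HCP (anticuboctahedron) kissing pattern (the hypothesis of the
landed layer theorem `ShellsToBarlowChart`, verbatim).  Expected witness: rigid images of relaxed hcp
(`a* ≈ 0.9713 ∈ [9/10,1]`, shell distortion `≈ 1e-4·a ≪ a/100`, next shell at `≈ 1.414a > 5a/4`).
Why it might fail: a uniformly `2e*`-bound configuration with an icosahedral / Frank–Kasper (Z14–Z16) /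
split shell somewhere — the bet of `M*` itself, here only at the first-shell scale; certification of any
instance needs `U > 2e*` at a nearby site, available `e*`-free as `U > 2e(hcp a h) ≥ 2e*`. -/
theorem stub_shellCensus :
    ∀ X : Set (EuclideanSpace ℝ (Fin 3)), X.Nonempty →
      (∃ δ : ℝ, 0 < δ ∧ ∀ p ∈ X, ∀ q ∈ X, p ≠ q → δ ≤ dist p q) →
      (∀ p ∈ X, ∑' q : {q : EuclideanSpace ℝ (Fin 3) // q ∈ X ∧ q ≠ p},
          lennardJones (dist p q.1) ≤
        2 * ⨅ Q : PeriodicConfiguration 3, Q.energyPerParticle lennardJones) →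
      (∃ R : ℝ, ∀ y : EuclideanSpace ℝ (Fin 3), ∃ p ∈ X, dist y p ≤ R) →
      ∀ x ∈ X, ∃ a : ℝ, 9 / 10 ≤ a ∧ a ≤ 1 ∧ ∃ T : Finset (EuclideanSpace ℝ (Fin 3)),
        (↑T : Set (EuclideanSpace ℝ (Fin 3))) =
            (fun y : EuclideanSpace ℝ (Fin 3) => y - x) ''
              {y : EuclideanSpace ℝ (Fin 3) | y ∈ X ∧ y ≠ x ∧ dist y x ≤ 5 / 4 * a} ∧
          (ShellCloseTo (a / 100) T
              (Finset.image (fun v : EuclideanSpace ℝ (Fin 3) => a • v) fccKissingPattern) ∨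
            ShellCloseTo (a / 100) T
              (Finset.image (fun v : EuclideanSpace ℝ (Fin 3) => a • v) hcpKissingPattern)) := by
  sorry

/-- **stub 3 — METRIC LOCK `(LOCK)`** (size XL, the HARDEST stub: one-sided Liouville on a fixed
topology): a non-empty, uniformly discrete, relatively dense, uniformly `2e*`-bound `X ⊆ ℝ³` whose first
shells are all `1 %`-close-packed AND which is globally bond-isomorphic to an ideal Barlow stacking
`barlowStacking 1 √(2/3) s` (`s` a Hägg sequence; ideal contacts ↔ pairs at distance in `(0, 28/25]` —
the conclusion of the landed layer theorem) is an EXACT rigid-motion image of a Barlow stacking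
`barlowStacking a h s'` with `(a, h)` in the registry box `47/50 ≤ a ≤ 1`, `39a/50 ≤ h ≤ 17a/20`.
Mechanism: the displacement field `u = Φ − (rigid)` has `1 %` discrete gradients everywhere and no
defects; zero slack (`U ≤ 2e*` at every site, super-bound sites sparse — landed `Negative/SparseSuperBinding`)
plus zero site stress / phonon coercivity of the relaxed stacking force `∇u ≡ const` (one-sided
Liouville, card `Ideas/one-sided-liouville.md`), and `U ≤ 2e* ≤ 2e(hcp a' h')` for all `a', h'` pins the
lattice parameters to the `e_hcp`-minimiser inside the box.  Why it might fail: a uniformly bound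
NON-affine elastic state of a Barlow stacking (a zero-energy-cost bending mode at the level of site
sums), or lattice parameters of a uniformly bound polytype outside the box. -/
theorem stub_metricLock :
    ∀ X : Set (EuclideanSpace ℝ (Fin 3)), X.Nonempty →
      (∃ δ : ℝ, 0 < δ ∧ ∀ p ∈ X, ∀ q ∈ X, p ≠ q → δ ≤ dist p q) →
      (∀ p ∈ X, ∑' q : {q : EuclideanSpace ℝ (Fin 3) // q ∈ X ∧ q ≠ p},
          lennardJones (dist p q.1) ≤
        2 * ⨅ Q : PeriodicConfiguration 3, Q.energyPerParticle lennardJones) →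
      (∃ R : ℝ, ∀ y : EuclideanSpace ℝ (Fin 3), ∃ p ∈ X, dist y p ≤ R) →
      (∀ x ∈ X, ∃ a : ℝ, 9 / 10 ≤ a ∧ a ≤ 1 ∧ ∃ T : Finset (EuclideanSpace ℝ (Fin 3)),
        (↑T : Set (EuclideanSpace ℝ (Fin 3))) =
            (fun y : EuclideanSpace ℝ (Fin 3) => y - x) ''
              {y : EuclideanSpace ℝ (Fin 3) | y ∈ X ∧ y ≠ x ∧ dist y x ≤ 5 / 4 * a} ∧
          (ShellCloseTo (a / 100) T
              (Finset.image (fun v : EuclideanSpace ℝ (Fin 3) => a • v) fccKissingPattern) ∨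
            ShellCloseTo (a / 100) T
              (Finset.image (fun v : EuclideanSpace ℝ (Fin 3) => a • v) hcpKissingPattern))) →
      (∃ s : ℤ → ℤ, IsHaggSeq s ∧ ∃ Φ : EuclideanSpace ℝ (Fin 3) → EuclideanSpace ℝ (Fin 3),
        Set.BijOn Φ (barlowStacking 1 (Real.sqrt (2 / 3)) s) X ∧
          ∀ p ∈ barlowStacking 1 (Real.sqrt (2 / 3)) s, ∀ q ∈ barlowStacking 1 (Real.sqrt (2 / 3)) s,
            (dist p q = 1 ↔ (0 < dist (Φ p) (Φ q) ∧ dist (Φ p) (Φ q) ≤ 28 / 25))) →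
      ∃ a h : ℝ, 47 / 50 ≤ a ∧ a ≤ 1 ∧ 39 / 50 * a ≤ h ∧ h ≤ 17 / 20 * a ∧
        ∃ s' : ℤ → ℤ, IsHaggSeq s' ∧
          ∃ (A : EuclideanSpace ℝ (Fin 3) ≃ₗᵢ[ℝ] EuclideanSpace ℝ (Fin 3))
            (v : EuclideanSpace ℝ (Fin 3)),
            X = (fun z => A z + v) '' barlowStacking a h s' := by
  sorry

/-! ## The composition (kernel-checked, no `sorry`) -/

/-- **The Barlow chart from `(CENSUS)`, the landed layer theorem and `(LOCK)`**: the statement of the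
registered `stub_barlowChart` / the planned split child `UniformBindingIsBarlow`, DERIVED.  The global
combinatorics (layering, Hägg word, bond bijection) is the closed sibling crux `ShellsToBarlowChart`
(stmt-9227, `ShellsToBarlowChart_of`). [folklore] -/
theorem barlowChart_of_census_lock
    (hCensus : ∀ X : Set (EuclideanSpace ℝ (Fin 3)), X.Nonempty →
      (∃ δ : ℝ, 0 < δ ∧ ∀ p ∈ X, ∀ q ∈ X, p ≠ q → δ ≤ dist p q) →
      (∀ p ∈ X, ∑' q : {q : EuclideanSpace ℝ (Fin 3) // q ∈ X ∧ q ≠ p},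
          lennardJones (dist p q.1) ≤
        2 * ⨅ Q : PeriodicConfiguration 3, Q.energyPerParticle lennardJones) →
      (∃ R : ℝ, ∀ y : EuclideanSpace ℝ (Fin 3), ∃ p ∈ X, dist y p ≤ R) →
      ∀ x ∈ X, ∃ a : ℝ, 9 / 10 ≤ a ∧ a ≤ 1 ∧ ∃ T : Finset (EuclideanSpace ℝ (Fin 3)),
        (↑T : Set (EuclideanSpace ℝ (Fin 3))) =
            (fun y : EuclideanSpace ℝ (Fin 3) => y - x) ''
              {y : EuclideanSpace ℝ (Fin 3) | y ∈ X ∧ y ≠ x ∧ dist y x ≤ 5 / 4 * a} ∧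
          (ShellCloseTo (a / 100) T
              (Finset.image (fun v : EuclideanSpace ℝ (Fin 3) => a • v) fccKissingPattern) ∨
            ShellCloseTo (a / 100) T
              (Finset.image (fun v : EuclideanSpace ℝ (Fin 3) => a • v) hcpKissingPattern)))
    (hLock : ∀ X : Set (EuclideanSpace ℝ (Fin 3)), X.Nonempty →
      (∃ δ : ℝ, 0 < δ ∧ ∀ p ∈ X, ∀ q ∈ X, p ≠ q → δ ≤ dist p q) →
      (∀ p ∈ X, ∑' q : {q : EuclideanSpace ℝ (Fin 3) // q ∈ X ∧ q ≠ p},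
          lennardJones (dist p q.1) ≤
        2 * ⨅ Q : PeriodicConfiguration 3, Q.energyPerParticle lennardJones) →
      (∃ R : ℝ, ∀ y : EuclideanSpace ℝ (Fin 3), ∃ p ∈ X, dist y p ≤ R) →
      (∀ x ∈ X, ∃ a : ℝ, 9 / 10 ≤ a ∧ a ≤ 1 ∧ ∃ T : Finset (EuclideanSpace ℝ (Fin 3)),
        (↑T : Set (EuclideanSpace ℝ (Fin 3))) =
            (fun y : EuclideanSpace ℝ (Fin 3) => y - x) ''
              {y : EuclideanSpace ℝ (Fin 3) | y ∈ X ∧ y ≠ x ∧ dist y x ≤ 5 / 4 * a} ∧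
          (ShellCloseTo (a / 100) T
              (Finset.image (fun v : EuclideanSpace ℝ (Fin 3) => a • v) fccKissingPattern) ∨
            ShellCloseTo (a / 100) T
              (Finset.image (fun v : EuclideanSpace ℝ (Fin 3) => a • v) hcpKissingPattern))) →
      (∃ s : ℤ → ℤ, IsHaggSeq s ∧ ∃ Φ : EuclideanSpace ℝ (Fin 3) → EuclideanSpace ℝ (Fin 3),
        Set.BijOn Φ (barlowStacking 1 (Real.sqrt (2 / 3)) s) X ∧
          ∀ p ∈ barlowStacking 1 (Real.sqrt (2 / 3)) s, ∀ q ∈ barlowStacking 1 (Real.sqrt (2 / 3)) s,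
            (dist p q = 1 ↔ (0 < dist (Φ p) (Φ q) ∧ dist (Φ p) (Φ q) ≤ 28 / 25))) →
      ∃ a h : ℝ, 47 / 50 ≤ a ∧ a ≤ 1 ∧ 39 / 50 * a ≤ h ∧ h ≤ 17 / 20 * a ∧
        ∃ s' : ℤ → ℤ, IsHaggSeq s' ∧
          ∃ (A : EuclideanSpace ℝ (Fin 3) ≃ₗᵢ[ℝ] EuclideanSpace ℝ (Fin 3))
            (v : EuclideanSpace ℝ (Fin 3)),
            X = (fun z => A z + v) '' barlowStacking a h s') :
    ∀ X : Set (EuclideanSpace ℝ (Fin 3)), X.Nonempty →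
      (∃ δ : ℝ, 0 < δ ∧ ∀ p ∈ X, ∀ q ∈ X, p ≠ q → δ ≤ dist p q) →
      (∀ p ∈ X, ∑' q : {q : EuclideanSpace ℝ (Fin 3) // q ∈ X ∧ q ≠ p},
          lennardJones (dist p q.1) ≤
        2 * ⨅ Q : PeriodicConfiguration 3, Q.energyPerParticle lennardJones) →
      (∃ R : ℝ, ∀ y : EuclideanSpace ℝ (Fin 3), ∃ p ∈ X, dist y p ≤ R) →
      ∃ a h : ℝ, 47 / 50 ≤ a ∧ a ≤ 1 ∧ 39 / 50 * a ≤ h ∧ h ≤ 17 / 20 * a ∧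
        ∃ s : ℤ → ℤ, IsHaggSeq s ∧
          ∃ (A : EuclideanSpace ℝ (Fin 3) ≃ₗᵢ[ℝ] EuclideanSpace ℝ (Fin 3))
            (v : EuclideanSpace ℝ (Fin 3)),
            X = (fun z => A z + v) '' barlowStacking a h s :=
  fun X hne hsep hU hcoh =>
    hLock X hne hsep hU hcoh (hCensus X hne hsep hU hcoh)
      (Cruxes.ShellsToBarlowChart.DevelopTheModelGrowthDescent.ShellsToBarlowChart_of X hne
        (hCensus X hne hsep hU hcoh))

/-- **SKELETON THEOREM — the crux `UniformBindingRigidity` BY NAME from the three stub statements**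
(arrow form; hypotheses = the stub statements verbatim): `(LOCAL♯)` gives `(CORE)` by the landed
`halfSpaceCore_of_localSharp` (p169668), and `(CORE)` with the derived chart feeds the landed split glue
`UniformBindingRigidity_of_subs` (p169444: cohesion parts VII/VIII, stacking lock p143502,
`barlowPeriodicConfiguration`, least-element lemma p143410). [folklore] -/
theorem uniformBindingRigidity_of_stubs
    (hLocal : ∀ (Y : Set (EuclideanSpace ℝ (Fin 3))) (u : EuclideanSpace ℝ (Fin 3)), ‖u‖ = 1 →
      (0 : EuclideanSpace ℝ (Fin 3)) ∈ Y →
      (∀ p ∈ Y, ∀ q ∈ Y, p ≠ q → 23 / 40 ≤ dist p q) →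
      (∀ q ∈ Y, inner ℝ q u ≤ 0) →
      (∀ p ∈ Y, dist p 0 ≤ 6 → ∑' q : {q : EuclideanSpace ℝ (Fin 3) // q ∈ Y ∧ q ≠ p},
          lennardJones (dist p q.1) ≤ -(711 / 500)) →
      False)
    (hCensus : ∀ X : Set (EuclideanSpace ℝ (Fin 3)), X.Nonempty →
      (∃ δ : ℝ, 0 < δ ∧ ∀ p ∈ X, ∀ q ∈ X, p ≠ q → δ ≤ dist p q) →
      (∀ p ∈ X, ∑' q : {q : EuclideanSpace ℝ (Fin 3) // q ∈ X ∧ q ≠ p},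
          lennardJones (dist p q.1) ≤
        2 * ⨅ Q : PeriodicConfiguration 3, Q.energyPerParticle lennardJones) →
      (∃ R : ℝ, ∀ y : EuclideanSpace ℝ (Fin 3), ∃ p ∈ X, dist y p ≤ R) →
      ∀ x ∈ X, ∃ a : ℝ, 9 / 10 ≤ a ∧ a ≤ 1 ∧ ∃ T : Finset (EuclideanSpace ℝ (Fin 3)),
        (↑T : Set (EuclideanSpace ℝ (Fin 3))) =
            (fun y : EuclideanSpace ℝ (Fin 3) => y - x) ''
              {y : EuclideanSpace ℝ (Fin 3) | y ∈ X ∧ y ≠ x ∧ dist y x ≤ 5 / 4 * a} ∧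
          (ShellCloseTo (a / 100) T
              (Finset.image (fun v : EuclideanSpace ℝ (Fin 3) => a • v) fccKissingPattern) ∨
            ShellCloseTo (a / 100) T
              (Finset.image (fun v : EuclideanSpace ℝ (Fin 3) => a • v) hcpKissingPattern)))
    (hLock : ∀ X : Set (EuclideanSpace ℝ (Fin 3)), X.Nonempty →
      (∃ δ : ℝ, 0 < δ ∧ ∀ p ∈ X, ∀ q ∈ X, p ≠ q → δ ≤ dist p q) →
      (∀ p ∈ X, ∑' q : {q : EuclideanSpace ℝ (Fin 3) // q ∈ X ∧ q ≠ p},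
          lennardJones (dist p q.1) ≤
        2 * ⨅ Q : PeriodicConfiguration 3, Q.energyPerParticle lennardJones) →
      (∃ R : ℝ, ∀ y : EuclideanSpace ℝ (Fin 3), ∃ p ∈ X, dist y p ≤ R) →
      (∀ x ∈ X, ∃ a : ℝ, 9 / 10 ≤ a ∧ a ≤ 1 ∧ ∃ T : Finset (EuclideanSpace ℝ (Fin 3)),
        (↑T : Set (EuclideanSpace ℝ (Fin 3))) =
            (fun y : EuclideanSpace ℝ (Fin 3) => y - x) ''
              {y : EuclideanSpace ℝ (Fin 3) | y ∈ X ∧ y ≠ x ∧ dist y x ≤ 5 / 4 * a} ∧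
          (ShellCloseTo (a / 100) T
              (Finset.image (fun v : EuclideanSpace ℝ (Fin 3) => a • v) fccKissingPattern) ∨
            ShellCloseTo (a / 100) T
              (Finset.image (fun v : EuclideanSpace ℝ (Fin 3) => a • v) hcpKissingPattern))) →
      (∃ s : ℤ → ℤ, IsHaggSeq s ∧ ∃ Φ : EuclideanSpace ℝ (Fin 3) → EuclideanSpace ℝ (Fin 3),
        Set.BijOn Φ (barlowStacking 1 (Real.sqrt (2 / 3)) s) X ∧
          ∀ p ∈ barlowStacking 1 (Real.sqrt (2 / 3)) s, ∀ q ∈ barlowStacking 1 (Real.sqrt (2 / 3)) s,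
            (dist p q = 1 ↔ (0 < dist (Φ p) (Φ q) ∧ dist (Φ p) (Φ q) ≤ 28 / 25))) →
      ∃ a h : ℝ, 47 / 50 ≤ a ∧ a ≤ 1 ∧ 39 / 50 * a ≤ h ∧ h ≤ 17 / 20 * a ∧
        ∃ s' : ℤ → ℤ, IsHaggSeq s' ∧
          ∃ (A : EuclideanSpace ℝ (Fin 3) ≃ₗᵢ[ℝ] EuclideanSpace ℝ (Fin 3))
            (v : EuclideanSpace ℝ (Fin 3)),
            X = (fun z => A z + v) '' barlowStacking a h s') :
    UniformBindingRigidity :=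
  Theorems.PerronTransitivityUniformBindingRigidity.UniformBindingRigidity_of_subs
    (Theorems.PerronTransitivityUniformBindingRigidity.halfSpaceCore_of_localSharp hLocal)
    (barlowChart_of_census_lock hCensus hLock)

/-- **SKELETON THEOREM — the crux BY NAME from the three registered stubs.**  Its only `sorryAx`
dependence is through `stub_localHalfSpaceCert`, `stub_shellCensus`, `stub_metricLock`. -/
theorem UniformBindingRigidity_of : UniformBindingRigidity :=
  uniformBindingRigidity_of_stubs stub_localHalfSpaceCert stub_shellCensus stub_metricLock

end Summit.AtomisticToContinuum.Crystallization.Cruxes.UniformBindingRigidity.ShellCensusLayerLock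

end
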